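import Literature.NumberTheory.EllipticCurves.TunnellWeightTwoQExpansionsProofs
import Literature.NumberTheory.EllipticCurves.TunnellThmTwoTrivHeckeProofs
import Literature.NumberTheory.EllipticCurves.TunnellThmTwoHeckeProofs
import HarnessLib

/-!
# `{g θ₂, g θ₈, g θ₃₂}` spans `S_{3/2}(128, 1)` and `{g θ₁, g θ₄, g θ₁₆}` spans `S_{3/2}(128, χ₂)`:
# the dimension input (CO) of Tunnell's Theorem 2, PROVED

Third file of the elementary route (`TunnellWeightTwoThetaProductsProofs`,
`TunnellWeightTwoQExpansionsProofs`) to the input "a basis for the space of cusp forms of weight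
`3/2`, level `128` and trivial character is `{g θ₂, g θ₈, g θ₃₂}`. Similarly, `{g θ₁, g θ₄, g θ₁₆}`
is a basis for the weight `3/2` cusp forms of level `128` and character `χ₈`" of Tunnell 1983,
Theorem 2 (p. 327), for which Tunnell cites the dimension formula of Cohen–Oesterlé [3]. Here the
containments

  `S_{3/2}(128, 1) ⊆ span {g θ₂, g θ₈, g θ₃₂}`     (`halfIntCuspForms_three_le_span_triv`),
  `S_{3/2}(128, χ₂) ⊆ span {g θ₁, g θ₄, g θ₁₆}`    (`halfIntCuspForms_three_le_span_chi2`)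

— exactly the hypotheses (CO) of `Tunnell1983_thm2_triv_of_span_of_shimuraNiwa`
(`TunnellThmTwoTrivHeckeProofs`) and `Tunnell1983_thm2_chi2_of_cohenOesterle_of_shimuraNiwa`
(`TunnellThmTwoHeckeProofs`) — are PROVED without any dimension formula in weight `3/2`, from
`dim S₂(Γ₀(128)) ≤ g(X₀(128)) = 9` (Manin's bound, `finrank_cuspForm_two_le_genusX0`) as follows.
For `f ∈ S_{3/2}(128, 1)` the products `f θ₁`, `f θ₄` lie in `S_{4/2}(128, 1) = S₂(Γ₀(128))`,
which is spanned by the nine theta products `g θ_s θ_t` (`exists_eq_sum_bForm_of_mem`); comparing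
the `q`-expansion coefficients of `f θ₁ = ∑ μ_j g θ_{s_j} θ_{t_j}` and `f θ₄ = ∑ ν_j g θ_{s_j} θ_{t_j}`
through `q²⁰` gives `42` linear equations in the `21 + 9 + 9` unknowns `a_f(0..20), μ, ν`; if
moreover `a_f(1) = a_f(3) = a_f(9) = 0` the only solution is zero (an explicit elimination,
`eq_zero_of_mem_triv_of_qCoeffs`), so `f θ₁ = 0` and `f = 0` (`θ ≢ 0`, identity theorem). Since
the coefficient vectors of `g θ₂, g θ₈, g θ₃₂` at `q¹, q³, q⁹` are `(1,2,1), (1,0,1), (1,0,-1)`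
(invertible), every `f ∈ S_{3/2}(128, 1)` differs from a combination of them by such an `f`, whence
the span statement. For `χ₂` one uses `f θ₂`, `f θ₈` (`χ₂² = 1`), coefficients through `q²²`, and
the normalisation at `q¹, q², q⁵` (`g θ₁, g θ₄, g θ₁₆ ↦ (1,2,2), (1,0,2), (1,0,0)`).

Consequences recorded: **Theorem 2 from the Shimura–Niwa identification alone**: `Tunnell1983_thm2_triv_of_shimuraNiwa`,
`Tunnell1983_thm2_chi2_of_shimuraNiwa`, `Tunnell1983_thm2_chi2_of_coeff` — the remaining input
(SN) being the identification of the `T(p²)`-eigenvalues of the two eigenforms with `a_p(E)` for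
all odd `p` (Shimura 1973, Main Theorem, with Niwa 1975 and the eigenforms of weight `2` and level
dividing `128`), which is not proved here.

The linear algebra is written out by machine-generated but kernel-checked `linear_combination`
certificates (exact rational elimination); the coefficient tables come from
`TunnellWeightTwoQExpansionsProofs` (`decide`). No named facts, no definitions.

## References

* J. B. Tunnell, *A classical Diophantine problem and modular forms of weight 3/2*, Invent. Math.
  72 (1983) 323–334, Thm 2 and p. 327. [Tunnell1983Congruent]
* H. Cohen, J. Oesterlé, *Dimensions des espaces de formes modulaires*, LNM 627 (1977) 69–78
  (the dimension formula Tunnell cites as [3]; replaced here by Manin's bound in weight `2`).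
* F. Diamond, J. Shurman, *A first course in modular forms*, GTM 228 (2005), Thm. 3.5.1.
  [DiamondShurman2005]
-/

noncomputable section

open scoped MatrixGroups

open UpperHalfPlane hiding I
open Complex Filter Topology

namespace Literature.NumberTheory.EllipticCurves.Tunnell1983

open Literature.NumberTheory.EllipticCurves.ModularForms

/-! ### The convolutions `∑_{i ≤ n} a(i) r_t(n - i)` (coefficients of `f θ_t`) written out -/

/-- `∑_{i ≤ 0} c(i) r_1(0 - i)` written out. [folklore] -/
theorem conv_thetaCoeff_one_0 (c : ℕ → ℂ) :
    ∑ i ∈ Finset.range (0 + 1), c i * (thetaCoeff 1 (0 - i) : ℂ) =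
      c 0 := by
  simp only [Finset.sum_range_succ, Finset.sum_range_zero, Nat.reduceSub, thetaCoeff_one_values]
  push_cast
  ring

/-- `∑_{i ≤ 1} c(i) r_1(1 - i)` written out. [folklore] -/
theorem conv_thetaCoeff_one_1 (c : ℕ → ℂ) :
    ∑ i ∈ Finset.range (1 + 1), c i * (thetaCoeff 1 (1 - i) : ℂ) =
      2 * c 0 + c 1 := by
  simp only [Finset.sum_range_succ, Finset.sum_range_zero, Nat.reduceSub, thetaCoeff_one_values]
  push_cast
  ring

/-- `∑_{i ≤ 2} c(i) r_1(2 - i)` written out. [folklore] -/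
theorem conv_thetaCoeff_one_2 (c : ℕ → ℂ) :
    ∑ i ∈ Finset.range (2 + 1), c i * (thetaCoeff 1 (2 - i) : ℂ) =
      2 * c 1 + c 2 := by
  simp only [Finset.sum_range_succ, Finset.sum_range_zero, Nat.reduceSub, thetaCoeff_one_values]
  push_cast
  ring

/-- `∑_{i ≤ 3} c(i) r_1(3 - i)` written out. [folklore] -/
theorem conv_thetaCoeff_one_3 (c : ℕ → ℂ) :
    ∑ i ∈ Finset.range (3 + 1), c i * (thetaCoeff 1 (3 - i) : ℂ) =
      2 * c 2 + c 3 := by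
  simp only [Finset.sum_range_succ, Finset.sum_range_zero, Nat.reduceSub, thetaCoeff_one_values]
  push_cast
  ring

/-- `∑_{i ≤ 4} c(i) r_1(4 - i)` written out. [folklore] -/
theorem conv_thetaCoeff_one_4 (c : ℕ → ℂ) :
    ∑ i ∈ Finset.range (4 + 1), c i * (thetaCoeff 1 (4 - i) : ℂ) =
      2 * c 0 + 2 * c 3 + c 4 := by
  simp only [Finset.sum_range_succ, Finset.sum_range_zero, Nat.reduceSub, thetaCoeff_one_values]
  push_cast
  ring

/-- `∑_{i ≤ 5} c(i) r_1(5 - i)` written out. [folklore] -/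
theorem conv_thetaCoeff_one_5 (c : ℕ → ℂ) :
    ∑ i ∈ Finset.range (5 + 1), c i * (thetaCoeff 1 (5 - i) : ℂ) =
      2 * c 1 + 2 * c 4 + c 5 := by
  simp only [Finset.sum_range_succ, Finset.sum_range_zero, Nat.reduceSub, thetaCoeff_one_values]
  push_cast
  ring

/-- `∑_{i ≤ 6} c(i) r_1(6 - i)` written out. [folklore] -/
theorem conv_thetaCoeff_one_6 (c : ℕ → ℂ) :
    ∑ i ∈ Finset.range (6 + 1), c i * (thetaCoeff 1 (6 - i) : ℂ) =
      2 * c 2 + 2 * c 5 + c 6 := by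
  simp only [Finset.sum_range_succ, Finset.sum_range_zero, Nat.reduceSub, thetaCoeff_one_values]
  push_cast
  ring

/-- `∑_{i ≤ 7} c(i) r_1(7 - i)` written out. [folklore] -/
theorem conv_thetaCoeff_one_7 (c : ℕ → ℂ) :
    ∑ i ∈ Finset.range (7 + 1), c i * (thetaCoeff 1 (7 - i) : ℂ) =
      2 * c 3 + 2 * c 6 + c 7 := by
  simp only [Finset.sum_range_succ, Finset.sum_range_zero, Nat.reduceSub, thetaCoeff_one_values]
  push_cast
  ring

/-- `∑_{i ≤ 8} c(i) r_1(8 - i)` written out. [folklore] -/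
theorem conv_thetaCoeff_one_8 (c : ℕ → ℂ) :
    ∑ i ∈ Finset.range (8 + 1), c i * (thetaCoeff 1 (8 - i) : ℂ) =
      2 * c 4 + 2 * c 7 + c 8 := by
  simp only [Finset.sum_range_succ, Finset.sum_range_zero, Nat.reduceSub, thetaCoeff_one_values]
  push_cast
  ring

/-- `∑_{i ≤ 9} c(i) r_1(9 - i)` written out. [folklore] -/
theorem conv_thetaCoeff_one_9 (c : ℕ → ℂ) :
    ∑ i ∈ Finset.range (9 + 1), c i * (thetaCoeff 1 (9 - i) : ℂ) =
      2 * c 0 + 2 * c 5 + 2 * c 8 + c 9 := by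
  simp only [Finset.sum_range_succ, Finset.sum_range_zero, Nat.reduceSub, thetaCoeff_one_values]
  push_cast
  ring

/-- `∑_{i ≤ 10} c(i) r_1(10 - i)` written out. [folklore] -/
theorem conv_thetaCoeff_one_10 (c : ℕ → ℂ) :
    ∑ i ∈ Finset.range (10 + 1), c i * (thetaCoeff 1 (10 - i) : ℂ) =
      2 * c 1 + 2 * c 6 + 2 * c 9 + c 10 := by
  simp only [Finset.sum_range_succ, Finset.sum_range_zero, Nat.reduceSub, thetaCoeff_one_values]
  push_cast
  ring

/-- `∑_{i ≤ 11} c(i) r_1(11 - i)` written out. [folklore] -/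
theorem conv_thetaCoeff_one_11 (c : ℕ → ℂ) :
    ∑ i ∈ Finset.range (11 + 1), c i * (thetaCoeff 1 (11 - i) : ℂ) =
      2 * c 2 + 2 * c 7 + 2 * c 10 + c 11 := by
  simp only [Finset.sum_range_succ, Finset.sum_range_zero, Nat.reduceSub, thetaCoeff_one_values]
  push_cast
  ring

/-- `∑_{i ≤ 12} c(i) r_1(12 - i)` written out. [folklore] -/
theorem conv_thetaCoeff_one_12 (c : ℕ → ℂ) :
    ∑ i ∈ Finset.range (12 + 1), c i * (thetaCoeff 1 (12 - i) : ℂ) =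
      2 * c 3 + 2 * c 8 + 2 * c 11 + c 12 := by
  simp only [Finset.sum_range_succ, Finset.sum_range_zero, Nat.reduceSub, thetaCoeff_one_values]
  push_cast
  ring

/-- `∑_{i ≤ 13} c(i) r_1(13 - i)` written out. [folklore] -/
theorem conv_thetaCoeff_one_13 (c : ℕ → ℂ) :
    ∑ i ∈ Finset.range (13 + 1), c i * (thetaCoeff 1 (13 - i) : ℂ) =
      2 * c 4 + 2 * c 9 + 2 * c 12 + c 13 := by
  simp only [Finset.sum_range_succ, Finset.sum_range_zero, Nat.reduceSub, thetaCoeff_one_values]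
  push_cast
  ring

/-- `∑_{i ≤ 14} c(i) r_1(14 - i)` written out. [folklore] -/
theorem conv_thetaCoeff_one_14 (c : ℕ → ℂ) :
    ∑ i ∈ Finset.range (14 + 1), c i * (thetaCoeff 1 (14 - i) : ℂ) =
      2 * c 5 + 2 * c 10 + 2 * c 13 + c 14 := by
  simp only [Finset.sum_range_succ, Finset.sum_range_zero, Nat.reduceSub, thetaCoeff_one_values]
  push_cast
  ring

/-- `∑_{i ≤ 15} c(i) r_1(15 - i)` written out. [folklore] -/
theorem conv_thetaCoeff_one_15 (c : ℕ → ℂ) :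
    ∑ i ∈ Finset.range (15 + 1), c i * (thetaCoeff 1 (15 - i) : ℂ) =
      2 * c 6 + 2 * c 11 + 2 * c 14 + c 15 := by
  simp only [Finset.sum_range_succ, Finset.sum_range_zero, Nat.reduceSub, thetaCoeff_one_values]
  push_cast
  ring

/-- `∑_{i ≤ 16} c(i) r_1(16 - i)` written out. [folklore] -/
theorem conv_thetaCoeff_one_16 (c : ℕ → ℂ) :
    ∑ i ∈ Finset.range (16 + 1), c i * (thetaCoeff 1 (16 - i) : ℂ) =
      2 * c 0 + 2 * c 7 + 2 * c 12 + 2 * c 15 + c 16 := by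
  simp only [Finset.sum_range_succ, Finset.sum_range_zero, Nat.reduceSub, thetaCoeff_one_values]
  push_cast
  ring

/-- `∑_{i ≤ 17} c(i) r_1(17 - i)` written out. [folklore] -/
theorem conv_thetaCoeff_one_17 (c : ℕ → ℂ) :
    ∑ i ∈ Finset.range (17 + 1), c i * (thetaCoeff 1 (17 - i) : ℂ) =
      2 * c 1 + 2 * c 8 + 2 * c 13 + 2 * c 16 + c 17 := by
  simp only [Finset.sum_range_succ, Finset.sum_range_zero, Nat.reduceSub, thetaCoeff_one_values]
  push_cast
  ring

/-- `∑_{i ≤ 18} c(i) r_1(18 - i)` written out. [folklore] -/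
theorem conv_thetaCoeff_one_18 (c : ℕ → ℂ) :
    ∑ i ∈ Finset.range (18 + 1), c i * (thetaCoeff 1 (18 - i) : ℂ) =
      2 * c 2 + 2 * c 9 + 2 * c 14 + 2 * c 17 + c 18 := by
  simp only [Finset.sum_range_succ, Finset.sum_range_zero, Nat.reduceSub, thetaCoeff_one_values]
  push_cast
  ring

/-- `∑_{i ≤ 19} c(i) r_1(19 - i)` written out. [folklore] -/
theorem conv_thetaCoeff_one_19 (c : ℕ → ℂ) :
    ∑ i ∈ Finset.range (19 + 1), c i * (thetaCoeff 1 (19 - i) : ℂ) =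
      2 * c 3 + 2 * c 10 + 2 * c 15 + 2 * c 18 + c 19 := by
  simp only [Finset.sum_range_succ, Finset.sum_range_zero, Nat.reduceSub, thetaCoeff_one_values]
  push_cast
  ring

/-- `∑_{i ≤ 20} c(i) r_1(20 - i)` written out. [folklore] -/
theorem conv_thetaCoeff_one_20 (c : ℕ → ℂ) :
    ∑ i ∈ Finset.range (20 + 1), c i * (thetaCoeff 1 (20 - i) : ℂ) =
      2 * c 4 + 2 * c 11 + 2 * c 16 + 2 * c 19 + c 20 := by
  simp only [Finset.sum_range_succ, Finset.sum_range_zero, Nat.reduceSub, thetaCoeff_one_values]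
  push_cast
  ring

/-- `∑_{i ≤ 0} c(i) r_4(0 - i)` written out. [folklore] -/
theorem conv_thetaCoeff_four_0 (c : ℕ → ℂ) :
    ∑ i ∈ Finset.range (0 + 1), c i * (thetaCoeff 4 (0 - i) : ℂ) =
      c 0 := by
  simp only [Finset.sum_range_succ, Finset.sum_range_zero, Nat.reduceSub, thetaCoeff_four_values]
  push_cast
  ring

/-- `∑_{i ≤ 1} c(i) r_4(1 - i)` written out. [folklore] -/
theorem conv_thetaCoeff_four_1 (c : ℕ → ℂ) :
    ∑ i ∈ Finset.range (1 + 1), c i * (thetaCoeff 4 (1 - i) : ℂ) =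
      c 1 := by
  simp only [Finset.sum_range_succ, Finset.sum_range_zero, Nat.reduceSub, thetaCoeff_four_values]
  push_cast
  ring

/-- `∑_{i ≤ 2} c(i) r_4(2 - i)` written out. [folklore] -/
theorem conv_thetaCoeff_four_2 (c : ℕ → ℂ) :
    ∑ i ∈ Finset.range (2 + 1), c i * (thetaCoeff 4 (2 - i) : ℂ) =
      c 2 := by
  simp only [Finset.sum_range_succ, Finset.sum_range_zero, Nat.reduceSub, thetaCoeff_four_values]
  push_cast
  ring

/-- `∑_{i ≤ 3} c(i) r_4(3 - i)` written out. [folklore] -/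
theorem conv_thetaCoeff_four_3 (c : ℕ → ℂ) :
    ∑ i ∈ Finset.range (3 + 1), c i * (thetaCoeff 4 (3 - i) : ℂ) =
      c 3 := by
  simp only [Finset.sum_range_succ, Finset.sum_range_zero, Nat.reduceSub, thetaCoeff_four_values]
  push_cast
  ring

/-- `∑_{i ≤ 4} c(i) r_4(4 - i)` written out. [folklore] -/
theorem conv_thetaCoeff_four_4 (c : ℕ → ℂ) :
    ∑ i ∈ Finset.range (4 + 1), c i * (thetaCoeff 4 (4 - i) : ℂ) =
      2 * c 0 + c 4 := by
  simp only [Finset.sum_range_succ, Finset.sum_range_zero, Nat.reduceSub, thetaCoeff_four_values]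
  push_cast
  ring

/-- `∑_{i ≤ 5} c(i) r_4(5 - i)` written out. [folklore] -/
theorem conv_thetaCoeff_four_5 (c : ℕ → ℂ) :
    ∑ i ∈ Finset.range (5 + 1), c i * (thetaCoeff 4 (5 - i) : ℂ) =
      2 * c 1 + c 5 := by
  simp only [Finset.sum_range_succ, Finset.sum_range_zero, Nat.reduceSub, thetaCoeff_four_values]
  push_cast
  ring

/-- `∑_{i ≤ 6} c(i) r_4(6 - i)` written out. [folklore] -/
theorem conv_thetaCoeff_four_6 (c : ℕ → ℂ) :
    ∑ i ∈ Finset.range (6 + 1), c i * (thetaCoeff 4 (6 - i) : ℂ) =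
      2 * c 2 + c 6 := by
  simp only [Finset.sum_range_succ, Finset.sum_range_zero, Nat.reduceSub, thetaCoeff_four_values]
  push_cast
  ring

/-- `∑_{i ≤ 7} c(i) r_4(7 - i)` written out. [folklore] -/
theorem conv_thetaCoeff_four_7 (c : ℕ → ℂ) :
    ∑ i ∈ Finset.range (7 + 1), c i * (thetaCoeff 4 (7 - i) : ℂ) =
      2 * c 3 + c 7 := by
  simp only [Finset.sum_range_succ, Finset.sum_range_zero, Nat.reduceSub, thetaCoeff_four_values]
  push_cast
  ring

/-- `∑_{i ≤ 8} c(i) r_4(8 - i)` written out. [folklore] -/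
theorem conv_thetaCoeff_four_8 (c : ℕ → ℂ) :
    ∑ i ∈ Finset.range (8 + 1), c i * (thetaCoeff 4 (8 - i) : ℂ) =
      2 * c 4 + c 8 := by
  simp only [Finset.sum_range_succ, Finset.sum_range_zero, Nat.reduceSub, thetaCoeff_four_values]
  push_cast
  ring

/-- `∑_{i ≤ 9} c(i) r_4(9 - i)` written out. [folklore] -/
theorem conv_thetaCoeff_four_9 (c : ℕ → ℂ) :
    ∑ i ∈ Finset.range (9 + 1), c i * (thetaCoeff 4 (9 - i) : ℂ) =
      2 * c 5 + c 9 := by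
  simp only [Finset.sum_range_succ, Finset.sum_range_zero, Nat.reduceSub, thetaCoeff_four_values]
  push_cast
  ring

/-- `∑_{i ≤ 10} c(i) r_4(10 - i)` written out. [folklore] -/
theorem conv_thetaCoeff_four_10 (c : ℕ → ℂ) :
    ∑ i ∈ Finset.range (10 + 1), c i * (thetaCoeff 4 (10 - i) : ℂ) =
      2 * c 6 + c 10 := by
  simp only [Finset.sum_range_succ, Finset.sum_range_zero, Nat.reduceSub, thetaCoeff_four_values]
  push_cast
  ring

/-- `∑_{i ≤ 11} c(i) r_4(11 - i)` written out. [folklore] -/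
theorem conv_thetaCoeff_four_11 (c : ℕ → ℂ) :
    ∑ i ∈ Finset.range (11 + 1), c i * (thetaCoeff 4 (11 - i) : ℂ) =
      2 * c 7 + c 11 := by
  simp only [Finset.sum_range_succ, Finset.sum_range_zero, Nat.reduceSub, thetaCoeff_four_values]
  push_cast
  ring

/-- `∑_{i ≤ 12} c(i) r_4(12 - i)` written out. [folklore] -/
theorem conv_thetaCoeff_four_12 (c : ℕ → ℂ) :
    ∑ i ∈ Finset.range (12 + 1), c i * (thetaCoeff 4 (12 - i) : ℂ) =
      2 * c 8 + c 12 := by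
  simp only [Finset.sum_range_succ, Finset.sum_range_zero, Nat.reduceSub, thetaCoeff_four_values]
  push_cast
  ring

/-- `∑_{i ≤ 13} c(i) r_4(13 - i)` written out. [folklore] -/
theorem conv_thetaCoeff_four_13 (c : ℕ → ℂ) :
    ∑ i ∈ Finset.range (13 + 1), c i * (thetaCoeff 4 (13 - i) : ℂ) =
      2 * c 9 + c 13 := by
  simp only [Finset.sum_range_succ, Finset.sum_range_zero, Nat.reduceSub, thetaCoeff_four_values]
  push_cast
  ring

/-- `∑_{i ≤ 14} c(i) r_4(14 - i)` written out. [folklore] -/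
theorem conv_thetaCoeff_four_14 (c : ℕ → ℂ) :
    ∑ i ∈ Finset.range (14 + 1), c i * (thetaCoeff 4 (14 - i) : ℂ) =
      2 * c 10 + c 14 := by
  simp only [Finset.sum_range_succ, Finset.sum_range_zero, Nat.reduceSub, thetaCoeff_four_values]
  push_cast
  ring

/-- `∑_{i ≤ 15} c(i) r_4(15 - i)` written out. [folklore] -/
theorem conv_thetaCoeff_four_15 (c : ℕ → ℂ) :
    ∑ i ∈ Finset.range (15 + 1), c i * (thetaCoeff 4 (15 - i) : ℂ) =
      2 * c 11 + c 15 := by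
  simp only [Finset.sum_range_succ, Finset.sum_range_zero, Nat.reduceSub, thetaCoeff_four_values]
  push_cast
  ring

/-- `∑_{i ≤ 16} c(i) r_4(16 - i)` written out. [folklore] -/
theorem conv_thetaCoeff_four_16 (c : ℕ → ℂ) :
    ∑ i ∈ Finset.range (16 + 1), c i * (thetaCoeff 4 (16 - i) : ℂ) =
      2 * c 0 + 2 * c 12 + c 16 := by
  simp only [Finset.sum_range_succ, Finset.sum_range_zero, Nat.reduceSub, thetaCoeff_four_values]
  push_cast
  ring

/-- `∑_{i ≤ 17} c(i) r_4(17 - i)` written out. [folklore] -/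
theorem conv_thetaCoeff_four_17 (c : ℕ → ℂ) :
    ∑ i ∈ Finset.range (17 + 1), c i * (thetaCoeff 4 (17 - i) : ℂ) =
      2 * c 1 + 2 * c 13 + c 17 := by
  simp only [Finset.sum_range_succ, Finset.sum_range_zero, Nat.reduceSub, thetaCoeff_four_values]
  push_cast
  ring

/-- `∑_{i ≤ 18} c(i) r_4(18 - i)` written out. [folklore] -/
theorem conv_thetaCoeff_four_18 (c : ℕ → ℂ) :
    ∑ i ∈ Finset.range (18 + 1), c i * (thetaCoeff 4 (18 - i) : ℂ) =
      2 * c 2 + 2 * c 14 + c 18 := by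
  simp only [Finset.sum_range_succ, Finset.sum_range_zero, Nat.reduceSub, thetaCoeff_four_values]
  push_cast
  ring

/-- `∑_{i ≤ 19} c(i) r_4(19 - i)` written out. [folklore] -/
theorem conv_thetaCoeff_four_19 (c : ℕ → ℂ) :
    ∑ i ∈ Finset.range (19 + 1), c i * (thetaCoeff 4 (19 - i) : ℂ) =
      2 * c 3 + 2 * c 15 + c 19 := by
  simp only [Finset.sum_range_succ, Finset.sum_range_zero, Nat.reduceSub, thetaCoeff_four_values]
  push_cast
  ring

/-- `∑_{i ≤ 20} c(i) r_4(20 - i)` written out. [folklore] -/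
theorem conv_thetaCoeff_four_20 (c : ℕ → ℂ) :
    ∑ i ∈ Finset.range (20 + 1), c i * (thetaCoeff 4 (20 - i) : ℂ) =
      2 * c 4 + 2 * c 16 + c 20 := by
  simp only [Finset.sum_range_succ, Finset.sum_range_zero, Nat.reduceSub, thetaCoeff_four_values]
  push_cast
  ring

/-- `∑_{i ≤ 0} c(i) r_2(0 - i)` written out. [folklore] -/
theorem conv_thetaCoeff_two_0 (c : ℕ → ℂ) :
    ∑ i ∈ Finset.range (0 + 1), c i * (thetaCoeff 2 (0 - i) : ℂ) =
      c 0 := by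
  simp only [Finset.sum_range_succ, Finset.sum_range_zero, Nat.reduceSub, thetaCoeff_two_values]
  push_cast
  ring

/-- `∑_{i ≤ 1} c(i) r_2(1 - i)` written out. [folklore] -/
theorem conv_thetaCoeff_two_1 (c : ℕ → ℂ) :
    ∑ i ∈ Finset.range (1 + 1), c i * (thetaCoeff 2 (1 - i) : ℂ) =
      c 1 := by
  simp only [Finset.sum_range_succ, Finset.sum_range_zero, Nat.reduceSub, thetaCoeff_two_values]
  push_cast
  ring

/-- `∑_{i ≤ 2} c(i) r_2(2 - i)` written out. [folklore] -/
theorem conv_thetaCoeff_two_2 (c : ℕ → ℂ) :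
    ∑ i ∈ Finset.range (2 + 1), c i * (thetaCoeff 2 (2 - i) : ℂ) =
      2 * c 0 + c 2 := by
  simp only [Finset.sum_range_succ, Finset.sum_range_zero, Nat.reduceSub, thetaCoeff_two_values]
  push_cast
  ring

/-- `∑_{i ≤ 3} c(i) r_2(3 - i)` written out. [folklore] -/
theorem conv_thetaCoeff_two_3 (c : ℕ → ℂ) :
    ∑ i ∈ Finset.range (3 + 1), c i * (thetaCoeff 2 (3 - i) : ℂ) =
      2 * c 1 + c 3 := by
  simp only [Finset.sum_range_succ, Finset.sum_range_zero, Nat.reduceSub, thetaCoeff_two_values]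
  push_cast
  ring

/-- `∑_{i ≤ 4} c(i) r_2(4 - i)` written out. [folklore] -/
theorem conv_thetaCoeff_two_4 (c : ℕ → ℂ) :
    ∑ i ∈ Finset.range (4 + 1), c i * (thetaCoeff 2 (4 - i) : ℂ) =
      2 * c 2 + c 4 := by
  simp only [Finset.sum_range_succ, Finset.sum_range_zero, Nat.reduceSub, thetaCoeff_two_values]
  push_cast
  ring

/-- `∑_{i ≤ 5} c(i) r_2(5 - i)` written out. [folklore] -/
theorem conv_thetaCoeff_two_5 (c : ℕ → ℂ) :
    ∑ i ∈ Finset.range (5 + 1), c i * (thetaCoeff 2 (5 - i) : ℂ) =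
      2 * c 3 + c 5 := by
  simp only [Finset.sum_range_succ, Finset.sum_range_zero, Nat.reduceSub, thetaCoeff_two_values]
  push_cast
  ring

/-- `∑_{i ≤ 6} c(i) r_2(6 - i)` written out. [folklore] -/
theorem conv_thetaCoeff_two_6 (c : ℕ → ℂ) :
    ∑ i ∈ Finset.range (6 + 1), c i * (thetaCoeff 2 (6 - i) : ℂ) =
      2 * c 4 + c 6 := by
  simp only [Finset.sum_range_succ, Finset.sum_range_zero, Nat.reduceSub, thetaCoeff_two_values]
  push_cast
  ring

/-- `∑_{i ≤ 7} c(i) r_2(7 - i)` written out. [folklore] -/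
theorem conv_thetaCoeff_two_7 (c : ℕ → ℂ) :
    ∑ i ∈ Finset.range (7 + 1), c i * (thetaCoeff 2 (7 - i) : ℂ) =
      2 * c 5 + c 7 := by
  simp only [Finset.sum_range_succ, Finset.sum_range_zero, Nat.reduceSub, thetaCoeff_two_values]
  push_cast
  ring

/-- `∑_{i ≤ 8} c(i) r_2(8 - i)` written out. [folklore] -/
theorem conv_thetaCoeff_two_8 (c : ℕ → ℂ) :
    ∑ i ∈ Finset.range (8 + 1), c i * (thetaCoeff 2 (8 - i) : ℂ) =
      2 * c 0 + 2 * c 6 + c 8 := by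
  simp only [Finset.sum_range_succ, Finset.sum_range_zero, Nat.reduceSub, thetaCoeff_two_values]
  push_cast
  ring

/-- `∑_{i ≤ 9} c(i) r_2(9 - i)` written out. [folklore] -/
theorem conv_thetaCoeff_two_9 (c : ℕ → ℂ) :
    ∑ i ∈ Finset.range (9 + 1), c i * (thetaCoeff 2 (9 - i) : ℂ) =
      2 * c 1 + 2 * c 7 + c 9 := by
  simp only [Finset.sum_range_succ, Finset.sum_range_zero, Nat.reduceSub, thetaCoeff_two_values]
  push_cast
  ring

/-- `∑_{i ≤ 10} c(i) r_2(10 - i)` written out. [folklore] -/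
theorem conv_thetaCoeff_two_10 (c : ℕ → ℂ) :
    ∑ i ∈ Finset.range (10 + 1), c i * (thetaCoeff 2 (10 - i) : ℂ) =
      2 * c 2 + 2 * c 8 + c 10 := by
  simp only [Finset.sum_range_succ, Finset.sum_range_zero, Nat.reduceSub, thetaCoeff_two_values]
  push_cast
  ring

/-- `∑_{i ≤ 11} c(i) r_2(11 - i)` written out. [folklore] -/
theorem conv_thetaCoeff_two_11 (c : ℕ → ℂ) :
    ∑ i ∈ Finset.range (11 + 1), c i * (thetaCoeff 2 (11 - i) : ℂ) =
      2 * c 3 + 2 * c 9 + c 11 := by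
  simp only [Finset.sum_range_succ, Finset.sum_range_zero, Nat.reduceSub, thetaCoeff_two_values]
  push_cast
  ring

/-- `∑_{i ≤ 12} c(i) r_2(12 - i)` written out. [folklore] -/
theorem conv_thetaCoeff_two_12 (c : ℕ → ℂ) :
    ∑ i ∈ Finset.range (12 + 1), c i * (thetaCoeff 2 (12 - i) : ℂ) =
      2 * c 4 + 2 * c 10 + c 12 := by
  simp only [Finset.sum_range_succ, Finset.sum_range_zero, Nat.reduceSub, thetaCoeff_two_values]
  push_cast
  ring

/-- `∑_{i ≤ 13} c(i) r_2(13 - i)` written out. [folklore] -/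
theorem conv_thetaCoeff_two_13 (c : ℕ → ℂ) :
    ∑ i ∈ Finset.range (13 + 1), c i * (thetaCoeff 2 (13 - i) : ℂ) =
      2 * c 5 + 2 * c 11 + c 13 := by
  simp only [Finset.sum_range_succ, Finset.sum_range_zero, Nat.reduceSub, thetaCoeff_two_values]
  push_cast
  ring

/-- `∑_{i ≤ 14} c(i) r_2(14 - i)` written out. [folklore] -/
theorem conv_thetaCoeff_two_14 (c : ℕ → ℂ) :
    ∑ i ∈ Finset.range (14 + 1), c i * (thetaCoeff 2 (14 - i) : ℂ) =
      2 * c 6 + 2 * c 12 + c 14 := by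
  simp only [Finset.sum_range_succ, Finset.sum_range_zero, Nat.reduceSub, thetaCoeff_two_values]
  push_cast
  ring

/-- `∑_{i ≤ 15} c(i) r_2(15 - i)` written out. [folklore] -/
theorem conv_thetaCoeff_two_15 (c : ℕ → ℂ) :
    ∑ i ∈ Finset.range (15 + 1), c i * (thetaCoeff 2 (15 - i) : ℂ) =
      2 * c 7 + 2 * c 13 + c 15 := by
  simp only [Finset.sum_range_succ, Finset.sum_range_zero, Nat.reduceSub, thetaCoeff_two_values]
  push_cast
  ring

/-- `∑_{i ≤ 16} c(i) r_2(16 - i)` written out. [folklore] -/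
theorem conv_thetaCoeff_two_16 (c : ℕ → ℂ) :
    ∑ i ∈ Finset.range (16 + 1), c i * (thetaCoeff 2 (16 - i) : ℂ) =
      2 * c 8 + 2 * c 14 + c 16 := by
  simp only [Finset.sum_range_succ, Finset.sum_range_zero, Nat.reduceSub, thetaCoeff_two_values]
  push_cast
  ring

/-- `∑_{i ≤ 17} c(i) r_2(17 - i)` written out. [folklore] -/
theorem conv_thetaCoeff_two_17 (c : ℕ → ℂ) :
    ∑ i ∈ Finset.range (17 + 1), c i * (thetaCoeff 2 (17 - i) : ℂ) =
      2 * c 9 + 2 * c 15 + c 17 := by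
  simp only [Finset.sum_range_succ, Finset.sum_range_zero, Nat.reduceSub, thetaCoeff_two_values]
  push_cast
  ring

/-- `∑_{i ≤ 18} c(i) r_2(18 - i)` written out. [folklore] -/
theorem conv_thetaCoeff_two_18 (c : ℕ → ℂ) :
    ∑ i ∈ Finset.range (18 + 1), c i * (thetaCoeff 2 (18 - i) : ℂ) =
      2 * c 0 + 2 * c 10 + 2 * c 16 + c 18 := by
  simp only [Finset.sum_range_succ, Finset.sum_range_zero, Nat.reduceSub, thetaCoeff_two_values]
  push_cast
  ring

/-- `∑_{i ≤ 19} c(i) r_2(19 - i)` written out. [folklore] -/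
theorem conv_thetaCoeff_two_19 (c : ℕ → ℂ) :
    ∑ i ∈ Finset.range (19 + 1), c i * (thetaCoeff 2 (19 - i) : ℂ) =
      2 * c 1 + 2 * c 11 + 2 * c 17 + c 19 := by
  simp only [Finset.sum_range_succ, Finset.sum_range_zero, Nat.reduceSub, thetaCoeff_two_values]
  push_cast
  ring

/-- `∑_{i ≤ 20} c(i) r_2(20 - i)` written out. [folklore] -/
theorem conv_thetaCoeff_two_20 (c : ℕ → ℂ) :
    ∑ i ∈ Finset.range (20 + 1), c i * (thetaCoeff 2 (20 - i) : ℂ) =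
      2 * c 2 + 2 * c 12 + 2 * c 18 + c 20 := by
  simp only [Finset.sum_range_succ, Finset.sum_range_zero, Nat.reduceSub, thetaCoeff_two_values]
  push_cast
  ring

/-- `∑_{i ≤ 21} c(i) r_2(21 - i)` written out. [folklore] -/
theorem conv_thetaCoeff_two_21 (c : ℕ → ℂ) :
    ∑ i ∈ Finset.range (21 + 1), c i * (thetaCoeff 2 (21 - i) : ℂ) =
      2 * c 3 + 2 * c 13 + 2 * c 19 + c 21 := by
  simp only [Finset.sum_range_succ, Finset.sum_range_zero, Nat.reduceSub, thetaCoeff_two_values]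
  push_cast
  ring

/-- `∑_{i ≤ 22} c(i) r_2(22 - i)` written out. [folklore] -/
theorem conv_thetaCoeff_two_22 (c : ℕ → ℂ) :
    ∑ i ∈ Finset.range (22 + 1), c i * (thetaCoeff 2 (22 - i) : ℂ) =
      2 * c 4 + 2 * c 14 + 2 * c 20 + c 22 := by
  simp only [Finset.sum_range_succ, Finset.sum_range_zero, Nat.reduceSub, thetaCoeff_two_values]
  push_cast
  ring

/-- `∑_{i ≤ 0} c(i) r_8(0 - i)` written out. [folklore] -/
theorem conv_thetaCoeff_eight_0 (c : ℕ → ℂ) :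
    ∑ i ∈ Finset.range (0 + 1), c i * (thetaCoeff 8 (0 - i) : ℂ) =
      c 0 := by
  simp only [Finset.sum_range_succ, Finset.sum_range_zero, Nat.reduceSub, thetaCoeff_eight_values]
  push_cast
  ring

/-- `∑_{i ≤ 1} c(i) r_8(1 - i)` written out. [folklore] -/
theorem conv_thetaCoeff_eight_1 (c : ℕ → ℂ) :
    ∑ i ∈ Finset.range (1 + 1), c i * (thetaCoeff 8 (1 - i) : ℂ) =
      c 1 := by
  simp only [Finset.sum_range_succ, Finset.sum_range_zero, Nat.reduceSub, thetaCoeff_eight_values]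
  push_cast
  ring

/-- `∑_{i ≤ 2} c(i) r_8(2 - i)` written out. [folklore] -/
theorem conv_thetaCoeff_eight_2 (c : ℕ → ℂ) :
    ∑ i ∈ Finset.range (2 + 1), c i * (thetaCoeff 8 (2 - i) : ℂ) =
      c 2 := by
  simp only [Finset.sum_range_succ, Finset.sum_range_zero, Nat.reduceSub, thetaCoeff_eight_values]
  push_cast
  ring

/-- `∑_{i ≤ 3} c(i) r_8(3 - i)` written out. [folklore] -/
theorem conv_thetaCoeff_eight_3 (c : ℕ → ℂ) :
    ∑ i ∈ Finset.range (3 + 1), c i * (thetaCoeff 8 (3 - i) : ℂ) =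
      c 3 := by
  simp only [Finset.sum_range_succ, Finset.sum_range_zero, Nat.reduceSub, thetaCoeff_eight_values]
  push_cast
  ring

/-- `∑_{i ≤ 4} c(i) r_8(4 - i)` written out. [folklore] -/
theorem conv_thetaCoeff_eight_4 (c : ℕ → ℂ) :
    ∑ i ∈ Finset.range (4 + 1), c i * (thetaCoeff 8 (4 - i) : ℂ) =
      c 4 := by
  simp only [Finset.sum_range_succ, Finset.sum_range_zero, Nat.reduceSub, thetaCoeff_eight_values]
  push_cast
  ring

/-- `∑_{i ≤ 5} c(i) r_8(5 - i)` written out. [folklore] -/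
theorem conv_thetaCoeff_eight_5 (c : ℕ → ℂ) :
    ∑ i ∈ Finset.range (5 + 1), c i * (thetaCoeff 8 (5 - i) : ℂ) =
      c 5 := by
  simp only [Finset.sum_range_succ, Finset.sum_range_zero, Nat.reduceSub, thetaCoeff_eight_values]
  push_cast
  ring

/-- `∑_{i ≤ 6} c(i) r_8(6 - i)` written out. [folklore] -/
theorem conv_thetaCoeff_eight_6 (c : ℕ → ℂ) :
    ∑ i ∈ Finset.range (6 + 1), c i * (thetaCoeff 8 (6 - i) : ℂ) =
      c 6 := by
  simp only [Finset.sum_range_succ, Finset.sum_range_zero, Nat.reduceSub, thetaCoeff_eight_values]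
  push_cast
  ring

/-- `∑_{i ≤ 7} c(i) r_8(7 - i)` written out. [folklore] -/
theorem conv_thetaCoeff_eight_7 (c : ℕ → ℂ) :
    ∑ i ∈ Finset.range (7 + 1), c i * (thetaCoeff 8 (7 - i) : ℂ) =
      c 7 := by
  simp only [Finset.sum_range_succ, Finset.sum_range_zero, Nat.reduceSub, thetaCoeff_eight_values]
  push_cast
  ring

/-- `∑_{i ≤ 8} c(i) r_8(8 - i)` written out. [folklore] -/
theorem conv_thetaCoeff_eight_8 (c : ℕ → ℂ) :
    ∑ i ∈ Finset.range (8 + 1), c i * (thetaCoeff 8 (8 - i) : ℂ) =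
      2 * c 0 + c 8 := by
  simp only [Finset.sum_range_succ, Finset.sum_range_zero, Nat.reduceSub, thetaCoeff_eight_values]
  push_cast
  ring

/-- `∑_{i ≤ 9} c(i) r_8(9 - i)` written out. [folklore] -/
theorem conv_thetaCoeff_eight_9 (c : ℕ → ℂ) :
    ∑ i ∈ Finset.range (9 + 1), c i * (thetaCoeff 8 (9 - i) : ℂ) =
      2 * c 1 + c 9 := by
  simp only [Finset.sum_range_succ, Finset.sum_range_zero, Nat.reduceSub, thetaCoeff_eight_values]
  push_cast
  ring

/-- `∑_{i ≤ 10} c(i) r_8(10 - i)` written out. [folklore] -/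
theorem conv_thetaCoeff_eight_10 (c : ℕ → ℂ) :
    ∑ i ∈ Finset.range (10 + 1), c i * (thetaCoeff 8 (10 - i) : ℂ) =
      2 * c 2 + c 10 := by
  simp only [Finset.sum_range_succ, Finset.sum_range_zero, Nat.reduceSub, thetaCoeff_eight_values]
  push_cast
  ring

/-- `∑_{i ≤ 11} c(i) r_8(11 - i)` written out. [folklore] -/
theorem conv_thetaCoeff_eight_11 (c : ℕ → ℂ) :
    ∑ i ∈ Finset.range (11 + 1), c i * (thetaCoeff 8 (11 - i) : ℂ) =
      2 * c 3 + c 11 := by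
  simp only [Finset.sum_range_succ, Finset.sum_range_zero, Nat.reduceSub, thetaCoeff_eight_values]
  push_cast
  ring

/-- `∑_{i ≤ 12} c(i) r_8(12 - i)` written out. [folklore] -/
theorem conv_thetaCoeff_eight_12 (c : ℕ → ℂ) :
    ∑ i ∈ Finset.range (12 + 1), c i * (thetaCoeff 8 (12 - i) : ℂ) =
      2 * c 4 + c 12 := by
  simp only [Finset.sum_range_succ, Finset.sum_range_zero, Nat.reduceSub, thetaCoeff_eight_values]
  push_cast
  ring

/-- `∑_{i ≤ 13} c(i) r_8(13 - i)` written out. [folklore] -/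
theorem conv_thetaCoeff_eight_13 (c : ℕ → ℂ) :
    ∑ i ∈ Finset.range (13 + 1), c i * (thetaCoeff 8 (13 - i) : ℂ) =
      2 * c 5 + c 13 := by
  simp only [Finset.sum_range_succ, Finset.sum_range_zero, Nat.reduceSub, thetaCoeff_eight_values]
  push_cast
  ring

/-- `∑_{i ≤ 14} c(i) r_8(14 - i)` written out. [folklore] -/
theorem conv_thetaCoeff_eight_14 (c : ℕ → ℂ) :
    ∑ i ∈ Finset.range (14 + 1), c i * (thetaCoeff 8 (14 - i) : ℂ) =
      2 * c 6 + c 14 := by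
  simp only [Finset.sum_range_succ, Finset.sum_range_zero, Nat.reduceSub, thetaCoeff_eight_values]
  push_cast
  ring

/-- `∑_{i ≤ 15} c(i) r_8(15 - i)` written out. [folklore] -/
theorem conv_thetaCoeff_eight_15 (c : ℕ → ℂ) :
    ∑ i ∈ Finset.range (15 + 1), c i * (thetaCoeff 8 (15 - i) : ℂ) =
      2 * c 7 + c 15 := by
  simp only [Finset.sum_range_succ, Finset.sum_range_zero, Nat.reduceSub, thetaCoeff_eight_values]
  push_cast
  ring

/-- `∑_{i ≤ 16} c(i) r_8(16 - i)` written out. [folklore] -/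
theorem conv_thetaCoeff_eight_16 (c : ℕ → ℂ) :
    ∑ i ∈ Finset.range (16 + 1), c i * (thetaCoeff 8 (16 - i) : ℂ) =
      2 * c 8 + c 16 := by
  simp only [Finset.sum_range_succ, Finset.sum_range_zero, Nat.reduceSub, thetaCoeff_eight_values]
  push_cast
  ring

/-- `∑_{i ≤ 17} c(i) r_8(17 - i)` written out. [folklore] -/
theorem conv_thetaCoeff_eight_17 (c : ℕ → ℂ) :
    ∑ i ∈ Finset.range (17 + 1), c i * (thetaCoeff 8 (17 - i) : ℂ) =
      2 * c 9 + c 17 := by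
  simp only [Finset.sum_range_succ, Finset.sum_range_zero, Nat.reduceSub, thetaCoeff_eight_values]
  push_cast
  ring

/-- `∑_{i ≤ 18} c(i) r_8(18 - i)` written out. [folklore] -/
theorem conv_thetaCoeff_eight_18 (c : ℕ → ℂ) :
    ∑ i ∈ Finset.range (18 + 1), c i * (thetaCoeff 8 (18 - i) : ℂ) =
      2 * c 10 + c 18 := by
  simp only [Finset.sum_range_succ, Finset.sum_range_zero, Nat.reduceSub, thetaCoeff_eight_values]
  push_cast
  ring

/-- `∑_{i ≤ 19} c(i) r_8(19 - i)` written out. [folklore] -/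
theorem conv_thetaCoeff_eight_19 (c : ℕ → ℂ) :
    ∑ i ∈ Finset.range (19 + 1), c i * (thetaCoeff 8 (19 - i) : ℂ) =
      2 * c 11 + c 19 := by
  simp only [Finset.sum_range_succ, Finset.sum_range_zero, Nat.reduceSub, thetaCoeff_eight_values]
  push_cast
  ring

/-- `∑_{i ≤ 20} c(i) r_8(20 - i)` written out. [folklore] -/
theorem conv_thetaCoeff_eight_20 (c : ℕ → ℂ) :
    ∑ i ∈ Finset.range (20 + 1), c i * (thetaCoeff 8 (20 - i) : ℂ) =
      2 * c 12 + c 20 := by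
  simp only [Finset.sum_range_succ, Finset.sum_range_zero, Nat.reduceSub, thetaCoeff_eight_values]
  push_cast
  ring

/-- `∑_{i ≤ 21} c(i) r_8(21 - i)` written out. [folklore] -/
theorem conv_thetaCoeff_eight_21 (c : ℕ → ℂ) :
    ∑ i ∈ Finset.range (21 + 1), c i * (thetaCoeff 8 (21 - i) : ℂ) =
      2 * c 13 + c 21 := by
  simp only [Finset.sum_range_succ, Finset.sum_range_zero, Nat.reduceSub, thetaCoeff_eight_values]
  push_cast
  ring

/-- `∑_{i ≤ 22} c(i) r_8(22 - i)` written out. [folklore] -/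
theorem conv_thetaCoeff_eight_22 (c : ℕ → ℂ) :
    ∑ i ∈ Finset.range (22 + 1), c i * (thetaCoeff 8 (22 - i) : ℂ) =
      2 * c 14 + c 22 := by
  simp only [Finset.sum_range_succ, Finset.sum_range_zero, Nat.reduceSub, thetaCoeff_eight_values]
  push_cast
  ring

/-! ### `q`-expansion coefficients of differences of combinations -/

/-- `qCoeffs (f - (a g₁ + b g₂ + d g₃)) = qCoeffs f - (a qCoeffs g₁ + b qCoeffs g₂ + d qCoeffs g₃)`
on `M_{k/2}(N, χ)`. [folklore] -/
theorem qCoeffs_sub_comb {k N : ℕ} {χ : DirichletCharacter ℂ N} {f g₁ g₂ g₃ : ℍ → ℂ}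
    (hf : f ∈ halfIntModularForms k N χ) (h₁ : g₁ ∈ halfIntModularForms k N χ)
    (h₂ : g₂ ∈ halfIntModularForms k N χ) (h₃ : g₃ ∈ halfIntModularForms k N χ) (a b d : ℂ)
    (n : ℕ) :
    qCoeffs (f - (a • g₁ + b • g₂ + d • g₃)) n =
      qCoeffs f n - (a * qCoeffs g₁ n + b * qCoeffs g₂ n + d * qCoeffs g₃ n) := by
  have e : f - (a • g₁ + b • g₂ + d • g₃) =
      (((⟨f, hf⟩ : halfIntModularForms k N χ) -
        (a • (⟨g₁, h₁⟩ : halfIntModularForms k N χ) + b • (⟨g₂, h₂⟩ : halfIntModularForms k N χ) +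
          d • (⟨g₃, h₃⟩ : halfIntModularForms k N χ)) : halfIntModularForms k N χ) : ℍ → ℂ) := rfl
  rw [e, show qCoeffs (((⟨f, hf⟩ : halfIntModularForms k N χ) -
        (a • (⟨g₁, h₁⟩ : halfIntModularForms k N χ) + b • (⟨g₂, h₂⟩ : halfIntModularForms k N χ) +
          d • (⟨g₃, h₃⟩ : halfIntModularForms k N χ)) : halfIntModularForms k N χ) : ℍ → ℂ) =
      qCoeffsₗ k N χ ((⟨f, hf⟩ : halfIntModularForms k N χ) -
        (a • (⟨g₁, h₁⟩ : halfIntModularForms k N χ) + b • (⟨g₂, h₂⟩ : halfIntModularForms k N χ) +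
          d • (⟨g₃, h₃⟩ : halfIntModularForms k N χ))) from rfl,
    map_sub, map_add, map_add, map_smul, map_smul, map_smul]
  rfl

/-- Values of the coefficients of `g θ_t` used in the normalisations:
`g θ₂ ↦ (a(1), a(3), a(9)) = (1, 2, 1)`, `g θ₈ ↦ (1, 0, 1)`, `g θ₃₂ ↦ (1, 0, -1)`;
`g θ₁ ↦ (a(1), a(2), a(5)) = (1, 2, 2)`, `g θ₄ ↦ (1, 0, 2)`, `g θ₁₆ ↦ (1, 0, 0)` (Tunnell p. 327).
[cite: Tunnell1983Congruent, p. 327] -/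
theorem qCoeffs_tunnellForm_values :
    (qCoeffs (tunnellForm 2) 1 = 1 ∧ qCoeffs (tunnellForm 2) 3 = 2 ∧ qCoeffs (tunnellForm 2) 9 = 1) ∧
    (qCoeffs (tunnellForm 8) 1 = 1 ∧ qCoeffs (tunnellForm 8) 3 = 0 ∧ qCoeffs (tunnellForm 8) 9 = 1) ∧
    (qCoeffs (tunnellForm 32) 1 = 1 ∧ qCoeffs (tunnellForm 32) 3 = 0 ∧
      qCoeffs (tunnellForm 32) 9 = -1) ∧
    (qCoeffs (tunnellForm 1) 1 = 1 ∧ qCoeffs (tunnellForm 1) 2 = 2 ∧ qCoeffs (tunnellForm 1) 5 = 2) ∧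
    (qCoeffs (tunnellForm 4) 1 = 1 ∧ qCoeffs (tunnellForm 4) 2 = 0 ∧ qCoeffs (tunnellForm 4) 5 = 2) ∧
    (qCoeffs (tunnellForm 16) 1 = 1 ∧ qCoeffs (tunnellForm 16) 2 = 0 ∧
      qCoeffs (tunnellForm 16) 5 = 0) :=
  ⟨⟨by rw [qCoeffs_tunnellForm_eq_gThetaCoeff (by norm_num)]; dsimp only; exact_mod_cast (by decide +kernel : gThetaCoeff 2 ((1 : ℕ) : ℤ) = 1),
      by rw [qCoeffs_tunnellForm_eq_gThetaCoeff (by norm_num)]; dsimp only; exact_mod_cast (by decide +kernel : gThetaCoeff 2 ((3 : ℕ) : ℤ) = 2),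
      by rw [qCoeffs_tunnellForm_eq_gThetaCoeff (by norm_num)]; dsimp only; exact_mod_cast (by decide +kernel : gThetaCoeff 2 ((9 : ℕ) : ℤ) = 1)⟩,
    ⟨by rw [qCoeffs_tunnellForm_eq_gThetaCoeff (by norm_num)]; dsimp only; exact_mod_cast (by decide +kernel : gThetaCoeff 8 ((1 : ℕ) : ℤ) = 1),
      by rw [qCoeffs_tunnellForm_eq_gThetaCoeff (by norm_num)]; dsimp only; exact_mod_cast (by decide +kernel : gThetaCoeff 8 ((3 : ℕ) : ℤ) = 0),
      by rw [qCoeffs_tunnellForm_eq_gThetaCoeff (by norm_num)]; dsimp only; exact_mod_cast (by decide +kernel : gThetaCoeff 8 ((9 : ℕ) : ℤ) = 1)⟩,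
    ⟨by rw [qCoeffs_tunnellForm_eq_gThetaCoeff (by norm_num)]; dsimp only; exact_mod_cast (by decide +kernel : gThetaCoeff 32 ((1 : ℕ) : ℤ) = 1),
      by rw [qCoeffs_tunnellForm_eq_gThetaCoeff (by norm_num)]; dsimp only; exact_mod_cast (by decide +kernel : gThetaCoeff 32 ((3 : ℕ) : ℤ) = 0),
      by rw [qCoeffs_tunnellForm_eq_gThetaCoeff (by norm_num)]; dsimp only; exact_mod_cast (by decide +kernel : gThetaCoeff 32 ((9 : ℕ) : ℤ) = -1)⟩,
    ⟨by rw [qCoeffs_tunnellForm_eq_gThetaCoeff (by norm_num)]; dsimp only; exact_mod_cast (by decide +kernel : gThetaCoeff 1 ((1 : ℕ) : ℤ) = 1),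
      by rw [qCoeffs_tunnellForm_eq_gThetaCoeff (by norm_num)]; dsimp only; exact_mod_cast (by decide +kernel : gThetaCoeff 1 ((2 : ℕ) : ℤ) = 2),
      by rw [qCoeffs_tunnellForm_eq_gThetaCoeff (by norm_num)]; dsimp only; exact_mod_cast (by decide +kernel : gThetaCoeff 1 ((5 : ℕ) : ℤ) = 2)⟩,
    ⟨by rw [qCoeffs_tunnellForm_eq_gThetaCoeff (by norm_num)]; dsimp only; exact_mod_cast (by decide +kernel : gThetaCoeff 4 ((1 : ℕ) : ℤ) = 1),
      by rw [qCoeffs_tunnellForm_eq_gThetaCoeff (by norm_num)]; dsimp only; exact_mod_cast (by decide +kernel : gThetaCoeff 4 ((2 : ℕ) : ℤ) = 0),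
      by rw [qCoeffs_tunnellForm_eq_gThetaCoeff (by norm_num)]; dsimp only; exact_mod_cast (by decide +kernel : gThetaCoeff 4 ((5 : ℕ) : ℤ) = 2)⟩,
    ⟨by rw [qCoeffs_tunnellForm_eq_gThetaCoeff (by norm_num)]; dsimp only; exact_mod_cast (by decide +kernel : gThetaCoeff 16 ((1 : ℕ) : ℤ) = 1),
      by rw [qCoeffs_tunnellForm_eq_gThetaCoeff (by norm_num)]; dsimp only; exact_mod_cast (by decide +kernel : gThetaCoeff 16 ((2 : ℕ) : ℤ) = 0),
      by rw [qCoeffs_tunnellForm_eq_gThetaCoeff (by norm_num)]; dsimp only; exact_mod_cast (by decide +kernel : gThetaCoeff 16 ((5 : ℕ) : ℤ) = 0)⟩⟩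

/-! ### Trivial character: `S_{3/2}(128, 1) ⊆ span {g θ₂, g θ₈, g θ₃₂}` -/

/-- **The vanishing lemma, trivial character.** If `f ∈ S_{3/2}(128, 1)` has
`a_f(1) = a_f(3) = a_f(9) = 0` then `f = 0`: writing `f θ₁ = ∑ μ_j g θ_{s_j} θ_{t_j}` and
`f θ₄ = ∑ ν_j g θ_{s_j} θ_{t_j}` in the basis of `S_{4/2}(128, 1)` and comparing coefficients through
`q²⁰` forces `μ = 0` (exact elimination over `ℚ`, `45` equations in `39` unknowns), so `f θ = 0`
and `f = 0`. [cite: Tunnell1983Congruent, p. 327] -/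
theorem eq_zero_of_mem_triv_of_qCoeffs {f : ℍ → ℂ} (hf : f ∈ halfIntCuspForms 3 128 1)
    (h1 : qCoeffs f 1 = 0) (h3 : qCoeffs f 3 = 0) (h9 : qCoeffs f 9 = 0) : f = 0 := by
  have hfM := halfIntCuspForms_le_halfIntModularForms 3 128 1 hf
  obtain ⟨μ, hμ⟩ := exists_eq_sum_bForm_of_mem (mul_thetaMul_mem_of_mem_triv hf (Or.inl rfl))
  obtain ⟨ν, hν⟩ :=
    exists_eq_sum_bForm_of_mem (mul_thetaMul_mem_of_mem_triv hf (Or.inr (Or.inl rfl)))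
  set c := qCoeffs f
  have EF : ∀ n, ∑ i ∈ Finset.range (n + 1), c i * (thetaCoeff 1 (n - i) : ℂ) =
      ∑ j, μ j * qCoeffs (bForm j) n := fun n ↦ by
    rw [← qCoeffs_mul_thetaMul hfM one_pos n, qCoeffs_eq_sum_of_eq_sum_bForm hμ n]
  have EG : ∀ n, ∑ i ∈ Finset.range (n + 1), c i * (thetaCoeff 4 (n - i) : ℂ) =
      ∑ j, ν j * qCoeffs (bForm j) n := fun n ↦ by
    rw [← qCoeffs_mul_thetaMul hfM (by norm_num) n, qCoeffs_eq_sum_of_eq_sum_bForm hν n]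
  have f0 := EF 0
  rw [conv_thetaCoeff_one_0, sum_mul_qCoeffs_bForm_0] at f0
  have f1 := EF 1
  rw [conv_thetaCoeff_one_1, sum_mul_qCoeffs_bForm_1] at f1
  have g1 := EG 1
  rw [conv_thetaCoeff_four_1, sum_mul_qCoeffs_bForm_1] at g1
  have f2 := EF 2
  rw [conv_thetaCoeff_one_2, sum_mul_qCoeffs_bForm_2] at f2
  have f3 := EF 3
  rw [conv_thetaCoeff_one_3, sum_mul_qCoeffs_bForm_3] at f3
  have g3 := EG 3
  rw [conv_thetaCoeff_four_3, sum_mul_qCoeffs_bForm_3] at g3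
  have f4 := EF 4
  rw [conv_thetaCoeff_one_4, sum_mul_qCoeffs_bForm_4] at f4
  have f5 := EF 5
  rw [conv_thetaCoeff_one_5, sum_mul_qCoeffs_bForm_5] at f5
  have f6 := EF 6
  rw [conv_thetaCoeff_one_6, sum_mul_qCoeffs_bForm_6] at f6
  have f7 := EF 7
  rw [conv_thetaCoeff_one_7, sum_mul_qCoeffs_bForm_7] at f7
  have g7 := EG 7
  rw [conv_thetaCoeff_four_7, sum_mul_qCoeffs_bForm_7] at g7
  have f8 := EF 8
  rw [conv_thetaCoeff_one_8, sum_mul_qCoeffs_bForm_8] at f8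
  have f9 := EF 9
  rw [conv_thetaCoeff_one_9, sum_mul_qCoeffs_bForm_9] at f9
  have g9 := EG 9
  rw [conv_thetaCoeff_four_9, sum_mul_qCoeffs_bForm_9] at g9
  have f10 := EF 10
  rw [conv_thetaCoeff_one_10, sum_mul_qCoeffs_bForm_10] at f10
  have f11 := EF 11
  rw [conv_thetaCoeff_one_11, sum_mul_qCoeffs_bForm_11] at f11
  have g11 := EG 11
  rw [conv_thetaCoeff_four_11, sum_mul_qCoeffs_bForm_11] at g11
  have f12 := EF 12
  rw [conv_thetaCoeff_one_12, sum_mul_qCoeffs_bForm_12] at f12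
  have g12 := EG 12
  rw [conv_thetaCoeff_four_12, sum_mul_qCoeffs_bForm_12] at g12
  have f13 := EF 13
  rw [conv_thetaCoeff_one_13, sum_mul_qCoeffs_bForm_13] at f13
  have f14 := EF 14
  rw [conv_thetaCoeff_one_14, sum_mul_qCoeffs_bForm_14] at f14
  have g14 := EG 14
  rw [conv_thetaCoeff_four_14, sum_mul_qCoeffs_bForm_14] at g14
  have f15 := EF 15
  rw [conv_thetaCoeff_one_15, sum_mul_qCoeffs_bForm_15] at f15
  have g15 := EG 15
  rw [conv_thetaCoeff_four_15, sum_mul_qCoeffs_bForm_15] at g15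
  have f16 := EF 16
  rw [conv_thetaCoeff_one_16, sum_mul_qCoeffs_bForm_16] at f16
  have f17 := EF 17
  rw [conv_thetaCoeff_one_17, sum_mul_qCoeffs_bForm_17] at f17
  have g17 := EG 17
  rw [conv_thetaCoeff_four_17, sum_mul_qCoeffs_bForm_17] at g17
  have f18 := EF 18
  rw [conv_thetaCoeff_one_18, sum_mul_qCoeffs_bForm_18] at f18
  have f19 := EF 19
  rw [conv_thetaCoeff_one_19, sum_mul_qCoeffs_bForm_19] at f19
  have g19 := EG 19
  rw [conv_thetaCoeff_four_19, sum_mul_qCoeffs_bForm_19] at g19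
  have m0 : μ 0 = 0 := by
    linear_combination (1/2 : ℂ) * f0 + (-1/96 : ℂ) * f1 + (1/96 : ℂ) * g1 + (-1/8 : ℂ) * g3
      + (-1/4 : ℂ) * f4 + (-1/24 : ℂ) * g7 + (1/8 : ℂ) * f8 + (-1/96 : ℂ) * f9 + (1/96 : ℂ) * g9
      + (-1/8 : ℂ) * g11 + (5/48 : ℂ) * f12 + (-7/48 : ℂ) * g12 + (-1/24 : ℂ) * g15
      + (1/48 : ℂ) * f16 + (-1/96 : ℂ) * f17 + (1/96 : ℂ) * g17 + (1/2 : ℂ) * h3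
  have m1 : μ 1 = 0 := by
    linear_combination (-1/2 : ℂ) * f0 + (1/96 : ℂ) * f1 + (17/96 : ℂ) * g1 + (-9/32 : ℂ) * f2
      + (3/32 : ℂ) * f3 + (1/32 : ℂ) * g3 + (1/4 : ℂ) * f4 + (1/8 : ℂ) * f7 + (-1/12 : ℂ) * g7
      + (-1/8 : ℂ) * f8 + (1/96 : ℂ) * f9 + (17/96 : ℂ) * g9 + (-1/4 : ℂ) * f10 + (9/64 : ℂ) * f11
      + (-1/64 : ℂ) * g11 + (-5/48 : ℂ) * f12 + (7/48 : ℂ) * g12 + (-3/16 : ℂ) * f14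
      + (1/8 : ℂ) * g14 + (1/8 : ℂ) * f15 + (-1/12 : ℂ) * g15 + (-1/48 : ℂ) * f16
      + (1/96 : ℂ) * f17 + (17/96 : ℂ) * g17 + (-3/32 : ℂ) * f18 + (3/64 : ℂ) * f19
      + (-3/64 : ℂ) * g19 + (1/2 : ℂ) * h1 + (-1/2 : ℂ) * h3 + (1/2 : ℂ) * h9
  have m2 : μ 2 = 0 := by
    linear_combination (-1/4 : ℂ) * g1 + (-1/8 : ℂ) * f2 + (-1/8 : ℂ) * f7 + (1/8 : ℂ) * g7
      + (-1/4 : ℂ) * g9 + (1/4 : ℂ) * f10 + (-1/16 : ℂ) * f11 + (1/16 : ℂ) * g11 + (1/4 : ℂ) * f14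
      + (-1/4 : ℂ) * g14 + (-1/8 : ℂ) * f15 + (1/8 : ℂ) * g15 + (-1/4 : ℂ) * g17 + (1/8 : ℂ) * f18
      + (-1/16 : ℂ) * f19 + (1/16 : ℂ) * g19 + (1/2 : ℂ) * h1 + (-1/2 : ℂ) * h9
  have m3 : μ 3 = 0 := by
    linear_combination (-1/2 : ℂ) * f0 + (1/96 : ℂ) * f1 + (11/96 : ℂ) * g1 + (-3/16 : ℂ) * f2
      + (1/16 : ℂ) * f3 + (3/16 : ℂ) * g3 + (1/4 : ℂ) * f4 + (-1/8 : ℂ) * f7 + (-1/12 : ℂ) * g7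
      + (-1/8 : ℂ) * f8 + (1/96 : ℂ) * f9 + (11/96 : ℂ) * g9 + (3/32 : ℂ) * f11 + (5/32 : ℂ) * g11
      + (-1/6 : ℂ) * f12 + (5/24 : ℂ) * g12 + (-1/8 : ℂ) * f14 + (1/8 : ℂ) * f15
      + (-1/12 : ℂ) * g15 + (-1/48 : ℂ) * f16 + (1/96 : ℂ) * f17 + (11/96 : ℂ) * g17
      + (-1/16 : ℂ) * f18 + (1/32 : ℂ) * f19 + (-1/32 : ℂ) * g19
  have m4 : μ 4 = 0 := by
    linear_combination (1/2 : ℂ) * f0 + (-13/96 : ℂ) * f1 + (-17/96 : ℂ) * g1 + (15/32 : ℂ) * f2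
      + (-5/32 : ℂ) * f3 + (-19/32 : ℂ) * g3 + (-1/4 : ℂ) * f4 + (-1/4 : ℂ) * f5
      + (-7/24 : ℂ) * g7 + (5/8 : ℂ) * f8 + (-13/96 : ℂ) * f9 + (-17/96 : ℂ) * g9
      + (1/4 : ℂ) * f10 + (-15/64 : ℂ) * f11 + (-33/64 : ℂ) * g11 + (11/12 : ℂ) * f12
      + (-23/24 : ℂ) * g12 + (-1/4 : ℂ) * f13 + (7/16 : ℂ) * f14 + (-1/4 : ℂ) * g14
      + (-1/4 : ℂ) * f15 + (-7/24 : ℂ) * g15 + (13/48 : ℂ) * f16 + (-13/96 : ℂ) * f17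
      + (-17/96 : ℂ) * g17 + (5/32 : ℂ) * f18 + (-5/64 : ℂ) * f19 + (5/64 : ℂ) * g19
  have m5 : μ 5 = 0 := by
    linear_combination (1/12 : ℂ) * f1 + (1/6 : ℂ) * g1 + (1/8 : ℂ) * f2 + (-1/8 : ℂ) * f3
      + (1/8 : ℂ) * g3 + (-1/4 : ℂ) * f5 + (1/4 : ℂ) * f6 + (1/16 : ℂ) * f7 + (13/48 : ℂ) * g7
      + (1/12 : ℂ) * f9 + (1/6 : ℂ) * g9 + (-1/4 : ℂ) * f10 + (-1/16 : ℂ) * f11 + (1/16 : ℂ) * g11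
      + (-1/3 : ℂ) * f12 + (1/6 : ℂ) * g12 + (1/4 : ℂ) * f13 + (-3/8 : ℂ) * f14 + (1/2 : ℂ) * g14
      + (1/16 : ℂ) * f15 + (13/48 : ℂ) * g15 + (-1/6 : ℂ) * f16 + (1/12 : ℂ) * f17
      + (1/6 : ℂ) * g17 + (-1/8 : ℂ) * f18 + (1/16 : ℂ) * f19 + (-1/16 : ℂ) * g19
  have m6 : μ 6 = 0 := by
    linear_combination (-1/4 : ℂ) * g1 + (3/8 : ℂ) * f2 + (-3/8 : ℂ) * f3 + (-1/4 : ℂ) * g3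
      + (1/8 : ℂ) * f7 + (1/8 : ℂ) * g7 + (-1/4 : ℂ) * g9 + (1/16 : ℂ) * f11 + (-3/16 : ℂ) * g11
      + (1/16 : ℂ) * f12 + (-1/16 : ℂ) * g12 + (1/4 : ℂ) * f14 + (-1/4 : ℂ) * g14
      + (-1/8 : ℂ) * f15 + (1/8 : ℂ) * g15 + (-1/4 : ℂ) * g17 + (1/8 : ℂ) * f18
      + (-1/16 : ℂ) * f19 + (1/16 : ℂ) * g19
  have m7 : μ 7 = 0 := by
    linear_combination (2 : ℂ) * f0 + (-7/24 : ℂ) * f1 + (1/24 : ℂ) * g1 + (-3/8 : ℂ) * f2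
      + (1/8 : ℂ) * f3 + (1 : ℂ) * g3 + (1/4 : ℂ) * f5 + (1/2 : ℂ) * f6 + (-1/4 : ℂ) * f7
      + (5/6 : ℂ) * g7 + (-1/2 : ℂ) * f8 + (-7/24 : ℂ) * f9 + (1/24 : ℂ) * g9 + (-5/16 : ℂ) * f11
      + (15/16 : ℂ) * g11 + (-55/48 : ℂ) * f12 + (71/48 : ℂ) * g12 + (1/4 : ℂ) * f13
      + (-3/8 : ℂ) * f14 + (5/8 : ℂ) * g14 + (5/6 : ℂ) * g15 + (-5/12 : ℂ) * f16
      + (5/24 : ℂ) * f17 + (1/24 : ℂ) * g17 + (-1/8 : ℂ) * f18 + (1/16 : ℂ) * f19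
      + (-1/16 : ℂ) * g19
  have m8 : μ 8 = 0 := by
    linear_combination (-2/3 : ℂ) * f1 + (1/6 : ℂ) * g1 + (3/8 : ℂ) * f3 + (-3/8 : ℂ) * g3
      + (1/4 : ℂ) * f5 + (-3/4 : ℂ) * f6 + (3/16 : ℂ) * f7 + (-41/48 : ℂ) * g7 + (1/3 : ℂ) * f9
      + (1/6 : ℂ) * g9 + (3/8 : ℂ) * f11 + (-3/8 : ℂ) * g11 + (2/3 : ℂ) * f12 + (-5/6 : ℂ) * g12
      + (-1/4 : ℂ) * f13 + (1/8 : ℂ) * f14 + (-1/2 : ℂ) * g14 + (3/16 : ℂ) * f15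
      + (-41/48 : ℂ) * g15 + (1/3 : ℂ) * f16 + (-1/6 : ℂ) * f17 + (1/6 : ℂ) * g17

  have hF : f * thetaMul 1 = 0 := by
    rw [hμ, sum_univ_nine, m0, m1, m2, m3, m4, m5, m6, m7, m8]
    simp
  refine eq_zero_of_mul_shimuraTheta_pow hf.1 1 fun z ↦ ?_
  rw [pow_one, ← thetaMul_one_eq_shimuraTheta]
  exact congrFun hF z

/-- **(CO), trivial character: `S_{3/2}(128, 1) ⊆ span {g θ₂, g θ₈, g θ₃₂}`** ("a basis for the
space of cusp forms of weight `3/2`, level `128` and trivial character is `{g θ₂, g θ₈, g θ₃₂}`",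
Tunnell p. 327, the spanning half): subtract from `f` the combination matching its coefficients at
`q¹, q³, q⁹` and apply the vanishing lemma. [cite: Tunnell1983Congruent, p. 327] -/
theorem halfIntCuspForms_three_le_span_triv :
    halfIntCuspForms 3 128 1 ≤
      Submodule.span ℂ {tunnellForm 2, tunnellForm 8, tunnellForm 32} := by
  intro f hf
  obtain ⟨⟨v21, v23, v29⟩, ⟨v81, v83, v89⟩, ⟨v321, v323, v329⟩, -, -, -⟩ :=
    qCoeffs_tunnellForm_values
  set c := qCoeffs f
  set S : Submodule ℂ (ℍ → ℂ) := Submodule.span ℂ {tunnellForm 2, tunnellForm 8, tunnellForm 32}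
  set g : ℍ → ℂ := (c 3 / 2) • tunnellForm 2 + ((c 1 + c 9) / 2 - c 3 / 2) • tunnellForm 8 +
    ((c 1 - c 9) / 2) • tunnellForm 32 with hg
  have hgS : g ∈ S :=
    add_mem (add_mem (Submodule.smul_mem _ _ (Submodule.subset_span (by simp)))
      (Submodule.smul_mem _ _ (Submodule.subset_span (by simp))))
      (Submodule.smul_mem _ _ (Submodule.subset_span (by simp)))
  have hgU : g ∈ halfIntCuspForms 3 128 1 :=
    add_mem (add_mem (Submodule.smul_mem _ _ tunnellForm_two_mem_halfIntCuspForms)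
      (Submodule.smul_mem _ _ tunnellForm_eight_mem_halfIntCuspForms))
      (Submodule.smul_mem _ _ tunnellForm_thirtytwo_mem_halfIntCuspForms)
  have hf' : f - g ∈ halfIntCuspForms 3 128 1 := sub_mem hf hgU
  have hM := halfIntCuspForms_le_halfIntModularForms 3 128 1
  have hq : ∀ n, qCoeffs (f - g) n = c n - (c 3 / 2 * qCoeffs (tunnellForm 2) n +
      ((c 1 + c 9) / 2 - c 3 / 2) * qCoeffs (tunnellForm 8) n +
      (c 1 - c 9) / 2 * qCoeffs (tunnellForm 32) n) := fun n ↦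
    qCoeffs_sub_comb (hM hf) (hM tunnellForm_two_mem_halfIntCuspForms)
      (hM tunnellForm_eight_mem_halfIntCuspForms) (hM tunnellForm_thirtytwo_mem_halfIntCuspForms)
      _ _ _ n
  have e1 : qCoeffs (f - g) 1 = 0 := by rw [hq, v21, v81, v321]; ring
  have e3 : qCoeffs (f - g) 3 = 0 := by rw [hq, v23, v83, v323]; ring
  have e9 : qCoeffs (f - g) 9 = 0 := by rw [hq, v29, v89, v329]; ring
  have h0 := eq_zero_of_mem_triv_of_qCoeffs hf' e1 e3 e9
  rw [sub_eq_zero] at h0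
  rw [h0]
  exact hgS


/-! ### Character `χ₂`: `S_{3/2}(128, χ₂) ⊆ span {g θ₁, g θ₄, g θ₁₆}` -/

/-- **The vanishing lemma, character `χ₂`.** If `f ∈ S_{3/2}(128, χ₂)` has
`a_f(1) = a_f(2) = a_f(5) = 0` then `f = 0`: compare the coefficients of
`f θ₂ = ∑ μ_j g θ_{s_j} θ_{t_j}`, `f θ₈ = ∑ ν_j g θ_{s_j} θ_{t_j}` (both in `S_{4/2}(128, 1)`, `χ₂² = 1`)
through `q²²` (`49` equations in `41` unknowns; elimination gives `μ = 0`), so `f θ₂ = 0` and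
`f = 0`. [cite: Tunnell1983Congruent, p. 327] -/
theorem eq_zero_of_mem_chi2_of_qCoeffs {f : ℍ → ℂ} (hf : f ∈ halfIntCuspForms 3 128 tunnellChar)
    (h1 : qCoeffs f 1 = 0) (h2 : qCoeffs f 2 = 0) (h5 : qCoeffs f 5 = 0) : f = 0 := by
  have hfM := halfIntCuspForms_le_halfIntModularForms 3 128 tunnellChar hf
  obtain ⟨μ, hμ⟩ := exists_eq_sum_bForm_of_mem (mul_thetaMul_mem_of_mem_chi2 hf (Or.inl rfl))
  obtain ⟨ν, hν⟩ :=
    exists_eq_sum_bForm_of_mem (mul_thetaMul_mem_of_mem_chi2 hf (Or.inr (Or.inl rfl)))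
  set c := qCoeffs f
  have EF : ∀ n, ∑ i ∈ Finset.range (n + 1), c i * (thetaCoeff 2 (n - i) : ℂ) =
      ∑ j, μ j * qCoeffs (bForm j) n := fun n ↦ by
    rw [← qCoeffs_mul_thetaMul hfM two_pos n, qCoeffs_eq_sum_of_eq_sum_bForm hμ n]
  have EG : ∀ n, ∑ i ∈ Finset.range (n + 1), c i * (thetaCoeff 8 (n - i) : ℂ) =
      ∑ j, ν j * qCoeffs (bForm j) n := fun n ↦ by
    rw [← qCoeffs_mul_thetaMul hfM (by norm_num) n, qCoeffs_eq_sum_of_eq_sum_bForm hν n]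
  have f0 := EF 0
  rw [conv_thetaCoeff_two_0, sum_mul_qCoeffs_bForm_0] at f0
  have f1 := EF 1
  rw [conv_thetaCoeff_two_1, sum_mul_qCoeffs_bForm_1] at f1
  have g1 := EG 1
  rw [conv_thetaCoeff_eight_1, sum_mul_qCoeffs_bForm_1] at g1
  have f2 := EF 2
  rw [conv_thetaCoeff_two_2, sum_mul_qCoeffs_bForm_2] at f2
  have f3 := EF 3
  rw [conv_thetaCoeff_two_3, sum_mul_qCoeffs_bForm_3] at f3
  have g3 := EG 3
  rw [conv_thetaCoeff_eight_3, sum_mul_qCoeffs_bForm_3] at g3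
  have f4 := EF 4
  rw [conv_thetaCoeff_two_4, sum_mul_qCoeffs_bForm_4] at f4
  have f5 := EF 5
  rw [conv_thetaCoeff_two_5, sum_mul_qCoeffs_bForm_5] at f5
  have g5 := EG 5
  rw [conv_thetaCoeff_eight_5, sum_mul_qCoeffs_bForm_5] at g5
  have f6 := EF 6
  rw [conv_thetaCoeff_two_6, sum_mul_qCoeffs_bForm_6] at f6
  have f7 := EF 7
  rw [conv_thetaCoeff_two_7, sum_mul_qCoeffs_bForm_7] at f7
  have g7 := EG 7
  rw [conv_thetaCoeff_eight_7, sum_mul_qCoeffs_bForm_7] at g7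
  have f8 := EF 8
  rw [conv_thetaCoeff_two_8, sum_mul_qCoeffs_bForm_8] at f8
  have f9 := EF 9
  rw [conv_thetaCoeff_two_9, sum_mul_qCoeffs_bForm_9] at f9
  have g9 := EG 9
  rw [conv_thetaCoeff_eight_9, sum_mul_qCoeffs_bForm_9] at g9
  have f10 := EF 10
  rw [conv_thetaCoeff_two_10, sum_mul_qCoeffs_bForm_10] at f10
  have f11 := EF 11
  rw [conv_thetaCoeff_two_11, sum_mul_qCoeffs_bForm_11] at f11
  have g11 := EG 11
  rw [conv_thetaCoeff_eight_11, sum_mul_qCoeffs_bForm_11] at g11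
  have f12 := EF 12
  rw [conv_thetaCoeff_two_12, sum_mul_qCoeffs_bForm_12] at f12
  have g12 := EG 12
  rw [conv_thetaCoeff_eight_12, sum_mul_qCoeffs_bForm_12] at g12
  have f13 := EF 13
  rw [conv_thetaCoeff_two_13, sum_mul_qCoeffs_bForm_13] at f13
  have g13 := EG 13
  rw [conv_thetaCoeff_eight_13, sum_mul_qCoeffs_bForm_13] at g13
  have f14 := EF 14
  rw [conv_thetaCoeff_two_14, sum_mul_qCoeffs_bForm_14] at f14
  have g14 := EG 14
  rw [conv_thetaCoeff_eight_14, sum_mul_qCoeffs_bForm_14] at g14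
  have f15 := EF 15
  rw [conv_thetaCoeff_two_15, sum_mul_qCoeffs_bForm_15] at f15
  have g15 := EG 15
  rw [conv_thetaCoeff_eight_15, sum_mul_qCoeffs_bForm_15] at g15
  have f17 := EF 17
  rw [conv_thetaCoeff_two_17, sum_mul_qCoeffs_bForm_17] at f17
  have g17 := EG 17
  rw [conv_thetaCoeff_eight_17, sum_mul_qCoeffs_bForm_17] at g17
  have f19 := EF 19
  rw [conv_thetaCoeff_two_19, sum_mul_qCoeffs_bForm_19] at f19
  have f21 := EF 21
  rw [conv_thetaCoeff_two_21, sum_mul_qCoeffs_bForm_21] at f21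
  have g21 := EG 21
  rw [conv_thetaCoeff_eight_21, sum_mul_qCoeffs_bForm_21] at g21
  have m0 : μ 0 = 0 := by
    linear_combination (-1/4 : ℂ) * f4 + (1/8 : ℂ) * g12 + (-1/16 : ℂ) * f14 + (1/16 : ℂ) * g14
      + (1/2 : ℂ) * h2
  have m1 : μ 1 = 0 := by
    linear_combination (-1 : ℂ) * f0 + (1/4 : ℂ) * f4 + (-1 : ℂ) * f6 + (1/2 : ℂ) * f8
      + (-1/4 : ℂ) * f10 + (1/8 : ℂ) * f12 + (3/4 : ℂ) * g12 + (-7/16 : ℂ) * f14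
      + (7/16 : ℂ) * g14
  have m2 : μ 2 = 0 := by
    linear_combination (2 : ℂ) * f0 + (-1/2 : ℂ) * f2 + (1 : ℂ) * f6 + (-1/2 : ℂ) * f8
      + (1/4 : ℂ) * f10 + (-1/8 : ℂ) * f12 + (-7/8 : ℂ) * g12 + (1/2 : ℂ) * f14 + (-1/2 : ℂ) * g14
  have m3 : μ 3 = 0 := by
    linear_combination (-1/16 : ℂ) * f1 + (1/16 : ℂ) * g1 + (1/4 : ℂ) * f4 + (-1/4 : ℂ) * f7
      + (1/8 : ℂ) * g7 + (-1/16 : ℂ) * f9 + (1/16 : ℂ) * g9 + (-1/8 : ℂ) * g12 + (1/16 : ℂ) * f14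
      + (-1/16 : ℂ) * g14 + (1/8 : ℂ) * g15 + (-1/16 : ℂ) * f17 + (1/16 : ℂ) * g17
      + (-1/2 : ℂ) * h2 + (1/2 : ℂ) * h5
  have m4 : μ 4 = 0 := by
    linear_combination (1 : ℂ) * f0 + (1/16 : ℂ) * f1 + (-5/16 : ℂ) * g1 + (1/4 : ℂ) * f3
      + (-1/4 : ℂ) * f4 + (-7/16 : ℂ) * f5 + (3/16 : ℂ) * g5 + (1 : ℂ) * f6 + (3/8 : ℂ) * f7
      + (-1/4 : ℂ) * g7 + (-1/2 : ℂ) * f8 + (1/16 : ℂ) * f9 + (-5/16 : ℂ) * g9 + (1/4 : ℂ) * f10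
      + (3/8 : ℂ) * f11 + (-1/8 : ℂ) * f12 + (-3/4 : ℂ) * g12 + (-5/16 : ℂ) * f13
      + (1/16 : ℂ) * g13 + (7/16 : ℂ) * f14 + (-7/16 : ℂ) * g14 + (1/8 : ℂ) * f15
      + (-1/4 : ℂ) * g15 + (1/16 : ℂ) * f17 + (-5/16 : ℂ) * g17 + (1/8 : ℂ) * f19
      + (-1/16 : ℂ) * f21 + (1/16 : ℂ) * g21
  have m5 : μ 5 = 0 := by
    linear_combination (-2 : ℂ) * f0 + (1/2 : ℂ) * g1 + (1/2 : ℂ) * f2 + (-1/2 : ℂ) * f3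
      + (1/2 : ℂ) * g3 + (1/8 : ℂ) * f5 + (-3/8 : ℂ) * g5 + (-1 : ℂ) * f6 + (-1/8 : ℂ) * f7
      + (1/8 : ℂ) * g7 + (1/2 : ℂ) * f8 + (1/2 : ℂ) * g9 + (-1/4 : ℂ) * f10 + (-3/4 : ℂ) * f11
      + (1/2 : ℂ) * g11 + (1/8 : ℂ) * f12 + (7/8 : ℂ) * g12 + (3/8 : ℂ) * f13 + (-1/8 : ℂ) * g13
      + (-1/2 : ℂ) * f14 + (1/2 : ℂ) * g14 + (-1/8 : ℂ) * f15 + (1/8 : ℂ) * g15 + (1/2 : ℂ) * g17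
      + (-1/4 : ℂ) * f19 + (1/8 : ℂ) * f21 + (-1/8 : ℂ) * g21
  have m6 : μ 6 = 0 := by
    linear_combination (1/16 : ℂ) * f1 + (1/16 : ℂ) * g1 + (-5/8 : ℂ) * f3 + (1/4 : ℂ) * g3
      + (3/32 : ℂ) * f5 + (-3/32 : ℂ) * g5 + (1/4 : ℂ) * f7 + (-1/8 : ℂ) * g7 + (1/16 : ℂ) * f9
      + (1/16 : ℂ) * g9 + (-3/16 : ℂ) * f11 + (1/4 : ℂ) * g11 + (1/32 : ℂ) * f13
      + (-1/32 : ℂ) * g13 + (-1/8 : ℂ) * g15 + (1/16 : ℂ) * f17 + (1/16 : ℂ) * g17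
      + (-1/16 : ℂ) * f19 + (1/32 : ℂ) * f21 + (-1/32 : ℂ) * g21 + (1 : ℂ) * h1 + (-1/2 : ℂ) * h5
  have m7 : μ 7 = 0 := by
    linear_combination (-13/16 : ℂ) * f1 + (7/16 : ℂ) * g1 + (5/8 : ℂ) * f3 + (-1/2 : ℂ) * g3
      + (11/32 : ℂ) * f5 + (-3/32 : ℂ) * g5 + (-3/8 : ℂ) * f7 + (3/4 : ℂ) * g7 + (-13/16 : ℂ) * f9
      + (7/16 : ℂ) * g9 + (1/16 : ℂ) * f11 + (-1/2 : ℂ) * g11 + (9/32 : ℂ) * f13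
      + (-1/32 : ℂ) * g13 + (-1/8 : ℂ) * f15 + (3/4 : ℂ) * g15 + (-5/16 : ℂ) * f17
      + (7/16 : ℂ) * g17 + (-1/16 : ℂ) * f19 + (1/32 : ℂ) * f21 + (-1/32 : ℂ) * g21
  have m8 : μ 8 = 0 := by
    linear_combination (-1/4 : ℂ) * f1 + (-3/4 : ℂ) * g1 + (1/4 : ℂ) * f3 + (-1/4 : ℂ) * g3
      + (-1/8 : ℂ) * f5 + (3/8 : ℂ) * g5 + (1/8 : ℂ) * f7 + (-5/8 : ℂ) * g7 + (3/4 : ℂ) * f9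
      + (-3/4 : ℂ) * g9 + (1/2 : ℂ) * f11 + (-1/4 : ℂ) * g11 + (-3/8 : ℂ) * f13 + (1/8 : ℂ) * g13
      + (1/8 : ℂ) * f15 + (-5/8 : ℂ) * g15 + (1/4 : ℂ) * f17 + (-3/4 : ℂ) * g17 + (1/4 : ℂ) * f19
      + (-1/8 : ℂ) * f21 + (1/8 : ℂ) * g21

  have hF : f * thetaMul 2 = 0 := by
    rw [hμ, sum_univ_nine, m0, m1, m2, m3, m4, m5, m6, m7, m8]
    simp
  -- `f θ₂ = 0` with `θ₂ = thetaMul 2` holomorphic and `≢ 0` (its constant term is `r_2(0) = 1`):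
  -- Mathlib's `UpperHalfPlane.mul_eq_zero_iff` (identity theorem on `ℍ`).
  have hθ := mdifferentiable_thetaMul (t := 2) two_pos
  have hθ0 : thetaMul 2 ≠ 0 := by
    intro h
    have h1 : qCoeffs (thetaMul 2) 0 = 0 := by rw [h, qCoeffs_zero, Pi.zero_apply]
    rw [qCoeffs_thetaMul two_pos] at h1
    have := thetaCoeff_two_values.1
    simp only [this, Int.cast_one, one_ne_zero] at h1
  rcases (UpperHalfPlane.mul_eq_zero_iff hf.1 hθ).mp hF with h0 | h0
  · exact h0
  · exact absurd h0 hθ0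

/-- **(CO), character `χ₂`: `S_{3/2}(128, χ₂) ⊆ span {g θ₁, g θ₄, g θ₁₆}`** ("Similarly,
`{g θ₁, g θ₄, g θ₁₆}` is a basis for the weight `3/2` cusp forms of level `128` and character `χ₈`",
Tunnell p. 327, spanning half): normalise at `q¹, q², q⁵`. [cite: Tunnell1983Congruent, p. 327] -/
theorem halfIntCuspForms_three_le_span_chi2 :
    halfIntCuspForms 3 128 tunnellChar ≤
      Submodule.span ℂ {tunnellForm 1, tunnellForm 4, tunnellForm 16} := by
  intro f hf
  obtain ⟨-, -, -, ⟨v11, v12, v15⟩, ⟨v41, v42, v45⟩, ⟨v161, v162, v165⟩⟩ :=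
    qCoeffs_tunnellForm_values
  set c := qCoeffs f
  set S : Submodule ℂ (ℍ → ℂ) := Submodule.span ℂ {tunnellForm 1, tunnellForm 4, tunnellForm 16}
  set g : ℍ → ℂ := (c 2 / 2) • tunnellForm 1 + (c 5 / 2 - c 2 / 2) • tunnellForm 4 +
    (c 1 - c 5 / 2) • tunnellForm 16 with hg
  have hgS : g ∈ S :=
    add_mem (add_mem (Submodule.smul_mem _ _ (Submodule.subset_span (by simp)))
      (Submodule.smul_mem _ _ (Submodule.subset_span (by simp))))
      (Submodule.smul_mem _ _ (Submodule.subset_span (by simp)))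
  have hgU : g ∈ halfIntCuspForms 3 128 tunnellChar :=
    add_mem (add_mem (Submodule.smul_mem _ _ tunnellForm_one_mem_halfIntCuspForms)
      (Submodule.smul_mem _ _ tunnellForm_four_mem_halfIntCuspForms))
      (Submodule.smul_mem _ _ tunnellForm_sixteen_mem_halfIntCuspForms)
  have hf' : f - g ∈ halfIntCuspForms 3 128 tunnellChar := sub_mem hf hgU
  have hM := halfIntCuspForms_le_halfIntModularForms 3 128 tunnellChar
  have hq : ∀ n, qCoeffs (f - g) n = c n - (c 2 / 2 * qCoeffs (tunnellForm 1) n +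
      (c 5 / 2 - c 2 / 2) * qCoeffs (tunnellForm 4) n +
      (c 1 - c 5 / 2) * qCoeffs (tunnellForm 16) n) := fun n ↦
    qCoeffs_sub_comb (hM hf) (hM tunnellForm_one_mem_halfIntCuspForms)
      (hM tunnellForm_four_mem_halfIntCuspForms) (hM tunnellForm_sixteen_mem_halfIntCuspForms)
      _ _ _ n
  have e1 : qCoeffs (f - g) 1 = 0 := by rw [hq, v11, v41, v161]; ring
  have e2 : qCoeffs (f - g) 2 = 0 := by rw [hq, v12, v42, v162]; ring
  have e5 : qCoeffs (f - g) 5 = 0 := by rw [hq, v15, v45, v165]; ring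
  have h0 := eq_zero_of_mem_chi2_of_qCoeffs hf' e1 e2 e5
  rw [sub_eq_zero] at h0
  rw [h0]
  exact hgS

/-! ### "Hence eigenforms for all `T(p²)`" — now unconditional -/

/-- **`g θ₈` is an eigenform of every `T(p²)`, `p` an odd prime** (Tunnell p. 327, "hence
eigenforms for all `T(p²)`"), unconditionally: `heckeTSq_tunnellForm_eight_eq_smul` with (CO)
proved. [cite: Tunnell1983Congruent, proof of Thm 2, pp. 327–328] -/
theorem heckeTSq_tunnellForm_eight_eigen {p : ℕ} (hp : p.Prime) (hp2 : p ≠ 2) :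
    heckeTSq 3 (1 : DirichletCharacter ℂ 128) p (qCoeffs (tunnellForm 8)) =
      heckeTSq 3 (1 : DirichletCharacter ℂ 128) p (qCoeffs (tunnellForm 8)) 1 •
        qCoeffs (tunnellForm 8) :=
  heckeTSq_tunnellForm_eight_eq_smul halfIntCuspForms_three_le_span_triv hp hp2

/-- **`g(θ₂ - θ₈)` is an eigenform of every `T(p²)`, `p` an odd prime**, unconditionally (the
eigenvalue is half the coefficient of `q³` of the image). [cite: Tunnell1983Congruent, proof of Thm 2, pp. 327–328] -/
theorem heckeTSq_two_sub_eight_eigen {p : ℕ} (hp : p.Prime) (hp2 : p ≠ 2) :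
    heckeTSq 3 (1 : DirichletCharacter ℂ 128) p (qCoeffs (tunnellForm 2 - tunnellForm 8)) =
      (heckeTSq 3 (1 : DirichletCharacter ℂ 128) p (qCoeffs (tunnellForm 2 - tunnellForm 8)) 3 / 2) •
        qCoeffs (tunnellForm 2 - tunnellForm 8) :=
  heckeTSq_two_sub_eight_eq_smul halfIntCuspForms_three_le_span_triv hp hp2

/-- **`g θ₁₆` is an eigenform of every `T(p²)`, `p` an odd prime**, unconditionally.
[cite: Tunnell1983Congruent, proof of Thm 2, pp. 327–328] -/
theorem heckeTSq_tunnellForm_sixteen_eigen {p : ℕ} (hp : p.Prime) (hp2 : p ≠ 2) :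
    heckeTSq 3 tunnellChar p (qCoeffs (tunnellForm 16)) =
      heckeTSq 3 tunnellChar p (qCoeffs (tunnellForm 16)) 1 • qCoeffs (tunnellForm 16) :=
  heckeTSq_tunnellForm_sixteen_eq_smul_of_span halfIntCuspForms_three_le_span_chi2 hp hp2

/-- **`g θ₄ - g θ₁₆` is an eigenform of every `T(p²)`, `p` an odd prime**, unconditionally.
[cite: Tunnell1983Congruent, proof of Thm 2, pp. 327–328] -/
theorem heckeTSq_four_sub_sixteen_eigen {p : ℕ} (hp : p.Prime) (hp2 : p ≠ 2) :
    heckeTSq 3 tunnellChar p (qCoeffs (tunnellForm 4 - tunnellForm 16)) =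
      (heckeTSq 3 tunnellChar p (qCoeffs (tunnellForm 4 - tunnellForm 16)) 5 / 2) •
        qCoeffs (tunnellForm 4 - tunnellForm 16) :=
  heckeTSq_four_sub_sixteen_eq_smul_of_span halfIntCuspForms_three_le_span_chi2 hp hp2

/-! ### Theorem 2 from the Shimura–Niwa identification alone -/

/-- **Tunnell 1983, Theorem 2 (trivial character), from (SN) alone.** With (CO) proved
(`halfIntCuspForms_three_le_span_triv`), `Tunnell1983_thm2_triv` follows from the single remaining
input: every nonzero common `T(p²)`-eigenform in `S_{3/2}(128, 1)` with `λ₃ = 0`, `λ₅ = -2` has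
eigenvalues `a_p(E)` at all odd primes (Shimura 1973, Main Thm, with Niwa 1975 and the
eigenforms of weight `2`, level dividing `128`; Tunnell pp. 327–328).
[cite: Tunnell1983Congruent, Thm 2 and its proof, pp. 327–328] -/
theorem Tunnell1983_thm2_triv_of_shimuraNiwa
    (hSN : ∀ f ∈ halfIntCuspForms 3 128 1, f ≠ 0 → ∀ ev : ℕ → ℂ,
      (∀ p : ℕ, p.Prime →
          heckeTSq 3 (1 : DirichletCharacter ℂ 128) p (qCoeffs f) = ev p • qCoeffs f) →
      ev 3 = 0 → ev 5 = -2 → ∀ p : ℕ, p.Prime → p ≠ 2 → ev p = tunnellEigenvalues p) :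
    Tunnell1983_thm2_triv :=
  Tunnell1983_thm2_triv_of_span_of_shimuraNiwa halfIntCuspForms_three_le_span_triv hSN

/-- **Tunnell 1983, Theorem 2 (character `χ₂`), from (SN) alone** (via
`Tunnell1983_thm2_chi2_of_cohenOesterle_of_shimuraNiwa` and the proved (CO)).
[cite: Tunnell1983Congruent, Thm 2 and its proof, pp. 327–328] -/
theorem Tunnell1983_thm2_chi2_of_shimuraNiwa
    (hSN : ∀ f ∈ halfIntCuspForms 3 128 tunnellChar, f ≠ 0 → ∀ ev : ℕ → ℂ,
      (∀ p : ℕ, p.Prime → heckeTSq 3 tunnellChar p (qCoeffs f) = ev p • qCoeffs f) →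
      ev 5 = -2 → ∀ p : ℕ, p.Prime → p ≠ 2 → ev p = tunnellEigenvalues p) :
    Tunnell1983_thm2_chi2 :=
  Tunnell1983_thm2_chi2_of_cohenOesterle_of_shimuraNiwa halfIntCuspForms_three_le_span_chi2 hSN

/-- **Tunnell 1983, Theorem 2 (character `χ₂`), from the two coefficient identities**
`d₁₆(p²) + χ₂(p) (-1/p) = a_p(E)` and `(d₄ - d₁₆)(5p²)/2 + χ₂(p) (-5/p) = a_p(E)` for odd primes `p`
(the `p`-th coefficients of the Shimura lifts; `Tunnell1983_thm2_chi2_of_cohenOesterle_of_coeff`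
with (CO) proved). [cite: Tunnell1983Congruent, Thm 2 and its proof, pp. 325, 327–328] -/
theorem Tunnell1983_thm2_chi2_of_coeff
    (h₁ : ∀ p : ℕ, p.Prime → p ≠ 2 →
      (formCoeff 16 (p ^ 2) : ℂ) + tunnellChar (p : ZMod 128) * (jacobiSym (-1) p : ℂ) =
        tunnellEigenvalues p)
    (h₅ : ∀ p : ℕ, p.Prime → p ≠ 2 →
      ((formCoeff 4 (5 * p ^ 2) : ℂ) - formCoeff 16 (5 * p ^ 2)) / 2 +
          tunnellChar (p : ZMod 128) * (jacobiSym (-5) p : ℂ) = tunnellEigenvalues p) :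
    Tunnell1983_thm2_chi2 :=
  Tunnell1983_thm2_chi2_of_cohenOesterle_of_coeff halfIntCuspForms_three_le_span_chi2 h₁ h₅

end Literature.NumberTheory.EllipticCurves.Tunnell1983
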